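import Literature.NumberTheory.LFunctions.Zhang2022.Section12U025Perron
import Literature.NumberTheory.LFunctions.Zhang2022.Section12ShiftedContourZ22
import Literature.NumberTheory.LFunctions.Zhang2022.Section12ShiftedSmallCircleOmega
import Literature.NumberTheory.LFunctions.Zhang2022.TypedSection12BRel
import Literature.NumberTheory.LFunctions.Zhang2022.AppendixALemma83RelHolds
import Literature.NumberTheory.LFunctions.Zhang2022.AppendixALemma83LocalEstimates
import Literature.NumberTheory.LFunctions.Zhang2022.Section12Eq1212OfRel
import Literature.NumberTheory.LFunctions.Zhang2022.Section12RelEdges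
import Literature.NumberTheory.LFunctions.Zhang2022.Section12U024RelHolds
import HarnessLib

/-!
# Zhang (2022) §12 p. 69, step u025 in the relative reading: `Typed.Sec12B.U025Rel` HOLDS,
# hence (12.10)ᴿ and the leaf (12.12) `Typed.Sec12C.Eq1212`

Topic `Literature/NumberTheory/LFunctions/Zhang2022` (Landau–Siegel audit tree; verdict-neutral).
Y. Zhang, *Discrete mean estimates and the Landau–Siegel zero*, arXiv:2211.02515v1 (2022)
[Zhang2022LandauSiegel], §12 proof of Lemma 12.2, p. 69, tex L3528–L3541 — **an unrefereed
manuscript under adjudication; nothing here asserts or denies its Theorems 1–2** (ZHANG-L discharge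
lane, WP12: the core `U025Rel` under leaf h1212 `Typed.Sec12C.Eq1212`).

The node `Typed.Sec12B.U025Rel c′` (TypedSection12BRel, the RELATIVE reading of record of Z22:§12.u025):
for `D` large, `χ` real primitive mod `D` with (A), `1 ≤ j ≤ 3`, `d, r ≥ 1`, `dr ≤ P″₁/T`, `|w| = α`,
`‖(2πi)⁻¹∫_{(1)}(Σ_lχ(l)ξ_j(l;d,r)l^{−(1−β₆+w+s)})((P″₂/dr)^s − (P″₁/dr)^s)ω₁(s)ds/s
   − L′(1,χ)Π(d,r)·(2πi)⁻¹∮_{|s|=5α}(s+w−β₆+β_{j+1})(s+w−β₆+β_{j+2})/(s+w−β₆)·((P″₂/dr)^s−(P″₁/dr)^s)ds/s‖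
 ≤ C𝓛⁻¹⁵·Π̂(dr)²`, `Π̂(n) = ∏_{q∣n}(1−q⁻¹)⁻¹` ("in a way similar to the proof of Lemma 8.4").

THIS FILE is the ASSEMBLY of the lane's layers (all tree theorems):
* Lemma 8.3 in the relative form (`Skeleton.lemma83Rel_holds`: the continuation `𝔲` with
  `𝔲(u) = L(u)Σχξ u^{·}/(L(u+β_{j+1})L(u+β_{j+2}))` on `Re u > 1`, `|𝔲| ≤ C∏(1+Cq^{−σ})` on `σ > 9/10`,
  `|𝔲(u) − Π(d,r)| ≤ C𝓛⁻⁸Π̂` on `|u−1| ≤ 5α`);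
* the Perron glue `Typed.Sec12B.lineInt024_eq_vline_sub` (Section12U025Perron): the Perron integral is
  the difference of the two vertical-line integrals `V(P″₂/dr) − V(P″₁/dr)` of
  `Φ(s) = 𝔲(1−β₆+w+s)L(·+β_{j+1})L(·+β_{j+2})/L(·)` against `Y^{1+it}ω₁(1+it)/(1+it)`;
* the big contour at the manuscript's objects (`Lemma84.ShiftedContour.norm_vline_sub_circ_le_Z22`,
  Section12ShiftedContourZ22): `‖V(Y) − (2πi)⁻¹∮_{C(β₆−w,3α)}Φ(z)Y^zω₁(z)/z dz‖ ≤ C₀𝓛⁻¹⁵`, `T ≤ Y ≤ P`;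
* the small circle with `ω₁` (`Lemma84.circ_omega1_pair_eval_forAllLarge`, Section12ShiftedSmallCircleOmega):
  the difference of the two `ω₁`-circle integrals is `Π(d,r)L′(1,χ)β_{j+1}β_{j+2}((P″₂/dr)^{β₆−w} −
  (P″₁/dr)^{β₆−w})/(β₆−w) + O(𝓛⁻¹⁵Π̂²)`;
* the residue computation `Typed.Sec12B.circ025_eq` (the closed form of the model circle integral).

RESULT: `Typed.Sec12B.u025Rel_of_lemma83Rel : Lemma83Rel c′ → U025Rel c′` and
**`Typed.Sec12B.u025Rel_holds : U025Rel c′`** (every `c′`); and, with the tree's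
`eq1210L15Rel_of_u024Rel_u025Rel` (Section12RelEdges), `u024Rel_holds` (Section12U024RelHolds) and
`Typed.Sec12C.eq1212_of_eq1210L15Rel'` (Section12Eq1212OfRel), the LEAF h1212 BY NAME:
**`Typed.Sec12C.eq1212_holds : 0 ≤ c′ → Eq1212 c′`** (and `eq1210L15Rel_holds`). 0 new definitions;
standard axioms. «ZHANG-L proves typed steps of arXiv:2211.02515v1 in Lean; the §18
margin is refuted as printed (G-C1); no claim about Landau–Siegel zeros or Theorem 2 follows.»

## References

* Y. Zhang, arXiv:2211.02515v1 (2022), §12 proof of Lemma 12.2, p. 69 (tex L3528–L3541); §8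
  Lemmas 8.3–8.4 pp. 46–47; §5 Lemmas 5.5, 5.7; §4 (4.1).
  [cite: Zhang2022LandauSiegel, §12 proof of Lemma 12.2, p. 69]
* H. L. Montgomery, R. C. Vaughan, *Multiplicative Number Theory I* (CUP 2007), §6.2 (Landau's
  contour), Thm 11.4. [cite: MontgomeryVaughan2007, §6.2]
-/

noncomputable section

open Complex Real MeasureTheory

namespace Literature.NumberTheory.LFunctions.Zhang2022.Typed.Sec12B

open Literature.NumberTheory.LFunctions.Zhang2022.Skeleton
open Literature.NumberTheory.LFunctions.Zhang2022.GaussWeight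

variable (c' : ℝ)

/-- `⌈x⌉₊ ≤ D` gives `x ≤ D` in `ℝ`. [folklore] -/
private theorem le_of_ceil_le {x : ℝ} {D : ℕ} (h : ⌈x⌉₊ ≤ D) : x ≤ (D : ℝ) :=
  (Nat.le_ceil x).trans (by exact_mod_cast h)

/-- **`U025Rel` from Lemma 8.3 (relative form)** — the u025 core of §12 p. 69 assembled from the
lane's layers: Perron glue (`lineInt024 = V(P″₂/dr) − V(P″₁/dr)`), the shifted big contour at the
manuscript's objects (twice, absolute `C₀𝓛⁻¹⁵`), the `ω₁`-small-circle pair evaluation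
(`C·𝓛⁻¹⁵Π̂(dr)²`), and the residue identity `circ025_eq`; total `(2C₀ + C)·𝓛⁻¹⁵·Π̂(dr)²`.
[cite: Zhang2022LandauSiegel, §12 proof of Lemma 12.2, p. 69, tex L3528–L3541]
[cite: MontgomeryVaughan2007, §6.2] -/
theorem u025Rel_of_lemma83Rel (h83 : Lemma83Rel c') : U025Rel c' := by
  obtain ⟨C83, D83, h83⟩ := h83
  set Cabs : ℝ := |C83| with hCabs
  have hCabs0 : 0 ≤ Cabs := abs_nonneg _
  obtain ⟨C₀, hC₀, D₁, hZ⟩ :=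
    Lemma84.ShiftedContour.norm_vline_sub_circ_le_Z22 (C₈₃ := Cabs) hCabs0 15
  obtain ⟨C₂, hC₂, D₂, hΩ⟩ := Lemma84.circ_omega1_pair_eval_forAllLarge c' Cabs
  obtain ⟨D₃, h025⟩ := circ025_eq c'
  refine ⟨2 * C₀ + C₂, max (max D83 D₁) (max (max D₂ D₃) ⌈Real.exp (10 * |c'| * π + 400)⌉₊),
    fun D _ χ hD hq hp hA j hj d r hd hr hdr w hw => ?_⟩
  -- thresholds
  have hD83 : D83 ≤ D := le_trans (le_trans (le_max_left _ _) (le_max_left _ _)) hD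
  have hD₁ : D₁ ≤ D := le_trans (le_trans (le_max_right _ _) (le_max_left _ _)) hD
  have hD₂ : D₂ ≤ D :=
    le_trans (le_trans (le_trans (le_max_left _ _) (le_max_left _ _)) (le_max_right _ _)) hD
  have hD₃ : D₃ ≤ D :=
    le_trans (le_trans (le_trans (le_max_right _ _) (le_max_left _ _)) (le_max_right _ _)) hD
  have hDexp : Real.exp (10 * |c'| * π + 400) ≤ D :=
    le_of_ceil_le (le_trans (le_trans (le_max_right _ _) (le_max_right _ _)) hD)
  obtain ⟨hℓ3, hα, hbsum, hαℓ⟩ := Lemma83.largeD_bounds c' hDexp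
  have hL3 : 3 ≤ Real.log D := hℓ3
  have hL1 : 1 ≤ Real.log D := by linarith
  have hD0 : (0 : ℝ) < D := lt_of_lt_of_le (Real.exp_pos _) hDexp
  have hD9r : (9 : ℝ) ≤ D := by
    have h := Real.add_one_le_exp (10 * |c'| * π + 400)
    have : 0 ≤ 10 * |c'| * π := by positivity
    linarith
  have hD9 : 9 ≤ D := by exact_mod_cast hD9r
  have hD3 : 3 ≤ D := le_trans (by norm_num) hD9
  have hD2 : 2 ≤ D := le_trans (by norm_num) hD9
  have hχ1 : χ ≠ 1 := Lemma31.ne_one_of_isPrimitive χ hD2 hp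
  have hA' : ‖χ.LFunction 1‖ < (Real.log D ^ 2022)⁻¹ := by
    have h := hA; rw [AssumptionA] at h; rwa [one_div] at h
  have hd0 : d ≠ 0 := Nat.one_le_iff_ne_zero.mp hd
  have hr0 : r ≠ 0 := Nat.one_le_iff_ne_zero.mp hr
  have hdr0 : 0 < ((d * r : ℕ) : ℝ) := by exact_mod_cast Nat.pos_of_ne_zero (mul_ne_zero hd0 hr0)
  -- `α`, `β`, `w`
  have hw' : -1 < w.re := neg_one_lt_re_of_norm_eq_alpha (alpha_lt_one hD9) hw
  have hβa_re : (betaJ c' D (j + 1)).re = 0 := Section8PerronSteps.betaJ_re c' D (j + 1)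
  have hβb_re : (betaJ c' D (j + 2)).re = 0 := Section8PerronSteps.betaJ_re c' D (j + 2)
  have hβ_norm : ∀ i : ℕ, ‖betaJ c' D i‖ ≤ 1 / 2 := by
    intro i
    have h1 := Lemma83.norm_betaJ_le c' D i
    have h3 : alpha D ≤ 1 / (112 * 3) := by
      rw [le_div_iff₀ (by norm_num)]
      have : alpha D * 3 ≤ alpha D * ell D := mul_le_mul_of_nonneg_left hℓ3 hα.le
      nlinarith
    linarith
  -- the shift `s₀ = β₆ − w`
  obtain ⟨-, hs₀norm, -⟩ := Lemma84.center_shift_bounds hα hw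
  have hs₀im : (beta6 D - w).im ≠ 0 := (beta6_sub_im_pos (D := D) hα hw).2
  -- the two cut-off points
  set Y₁ : ℝ := P1pp D / ((d * r : ℕ) : ℝ) with hY₁def
  set Y₂ : ℝ := P2pp D / ((d * r : ℕ) : ℝ) with hY₂def
  obtain ⟨⟨hTY₁, hY₁P⟩, ⟨hTY₂, hY₂P⟩⟩ := u025_cutoffs_mem (D := D) hL3 hd0 hr0 hdr
  have hT1 : 1 ≤ bigT D := by rw [bigT]; exact Real.one_le_exp (by positivity)
  have h1Y₁ : 1 ≤ Y₁ := hT1.trans hTY₁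
  have h1Y₂ : 1 ≤ Y₂ := hT1.trans hTY₂
  have hΛ1 : (1 : ℝ) ≤ ell D ^ 30 := one_le_pow₀ (by rw [ell]; exact hL1)
  -- `dr < PT⁻²` (the range of Lemma 8.3) and `log(dr) ≤ 𝓛⁹`
  have hP1lt : P1pp D < P2pp D := by
    have ht0 : 0 < t0 D := by rw [t0]; exact pow_pos (by rw [ell]; linarith) _
    have hP : 1 < bigP D := by
      rw [bigP]; exact Real.one_lt_exp_iff.mpr (pow_pos (by rw [ell]; linarith) _)
    have hpow : bigP D ^ (0.496 : ℝ) < bigP D ^ (0.5 : ℝ) :=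
      Real.rpow_lt_rpow_of_exponent_lt hP (by norm_num)
    unfold P1pp P2pp
    exact mul_lt_mul_of_pos_right (mul_lt_mul_of_pos_right hpow hD0) ht0
  have hdrP1 : ((d * r : ℕ) : ℝ) ≤ P1pp D :=
    hdr.trans (div_le_self (P1pp_pos hD3).le hT1)
  have hdrlt : ((d * r : ℕ) : ℝ) < bigP D / bigT D ^ 2 :=
    lt_of_lt_of_le (lt_of_le_of_lt hdrP1 hP1lt) (Sec12D.P2pp_le_P_div_T_sq hL3)
  have hlogn : Real.log ((d * r : ℕ) : ℝ) ≤ Real.log D ^ 9 := by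
    have h1 : ((d * r : ℕ) : ℝ) ≤ bigP D :=
      hdrP1.trans ((le_of_lt hP1lt).trans (P2pp_le_bigP hL3))
    calc Real.log ((d * r : ℕ) : ℝ) ≤ Real.log (bigP D) := Real.log_le_log hdr0 h1
      _ = Real.log D ^ 9 := by rw [bigP, Real.log_exp, ell]
  -- the continuation `𝔲` of Lemma 8.3 (relative form)
  obtain ⟨U, hUd, hU2, hUb, hU3⟩ := h83 D χ hD83 hq hp hA j hj d r hd hr hdrlt
  have hUb' : ∀ s : ℂ, 9 / 10 < s.re →
      ‖U s‖ ≤ Cabs * ∏ q ∈ (d * r).primeFactors, (1 + Cabs * (q : ℝ) ^ (-s.re)) := by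
    intro s hs
    calc ‖U s‖ ≤ C83 * ∏ q ∈ (d * r).primeFactors, (1 + C83 * (q : ℝ) ^ (-s.re)) := hUb s hs
      _ ≤ |C83 * ∏ q ∈ (d * r).primeFactors, (1 + C83 * (q : ℝ) ^ (-s.re))| := le_abs_self _
      _ = Cabs * ∏ q ∈ (d * r).primeFactors, |1 + C83 * (q : ℝ) ^ (-s.re)| := by
          rw [abs_mul, Finset.abs_prod]
      _ ≤ Cabs * ∏ q ∈ (d * r).primeFactors, (1 + Cabs * (q : ℝ) ^ (-s.re)) := by
          refine mul_le_mul_of_nonneg_left ?_ hCabs0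
          refine Finset.prod_le_prod (fun _ _ => abs_nonneg _) fun q _ => ?_
          calc |1 + C83 * (q : ℝ) ^ (-s.re)| ≤ |(1 : ℝ)| + |C83 * (q : ℝ) ^ (-s.re)| := abs_add_le _ _
            _ = 1 + Cabs * (q : ℝ) ^ (-s.re) := by
                rw [abs_one, abs_mul, abs_of_nonneg (Real.rpow_nonneg (Nat.cast_nonneg q) _)]
  have hU3' : ∀ s : ℂ, ‖s - 1‖ ≤ 5 * alpha D → ‖U s - PiW χ d r‖ ≤
      Cabs * (ell D ^ 8)⁻¹ * ∏ q ∈ (d * r).primeFactors, (1 - (q : ℝ)⁻¹)⁻¹ := by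
    intro s hs
    refine (hU3 s hs).trans ?_
    have := Literature.NumberTheory.Sieve.GreenTao2008.GYCorr.one_le_prod_one_sub_inv_inv (d * r)
    gcongr
    exact le_abs_self _
  -- the quotient `Φ` of the shifted contour layer
  set Φ : ℂ → ℂ := fun z => U (1 - beta6 D + w + z) *
      χ.LFunction (1 - beta6 D + w + z + betaJ c' D (j + 1)) *
      χ.LFunction (1 - beta6 D + w + z + betaJ c' D (j + 2)) /
      χ.LFunction (1 - beta6 D + w + z) with hΦdef
  have hΦ : ∀ s, Φ s = U (1 - (beta6 D - w) + s) *
      χ.LFunction (1 - (beta6 D - w) + s + betaJ c' D (j + 1)) *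
      χ.LFunction (1 - (beta6 D - w) + s + betaJ c' D (j + 2)) /
      χ.LFunction (1 - (beta6 D - w) + s) := by
    intro s
    rw [hΦdef]
    simp only []
    rw [show (1 : ℂ) - (beta6 D - w) + s = 1 - beta6 D + w + s by ring]
  -- (1) the Perron glue: `lineInt024 = V(Y₂) − V(Y₁)`
  have hglue := lineInt024_eq_vline_sub c' χ hD3 hd0 hr0 j hw' U Φ hU2 hΦ rfl
  -- (2) the big contour at `Y₂` and at `Y₁`
  have hZ₂ := hZ hD₁ χ hχ1 hA' U Φ (beta6 D - w) (betaJ c' D (j + 1)) (betaJ c' D (j + 2))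
    (n := d * r) (Y := Y₂) (mul_ne_zero hd0 hr0) hlogn hUd hUb' hβa_re (hβ_norm _) hβb_re (hβ_norm _)
    hs₀norm hs₀im hΦ hTY₂ hY₂P
  have hZ₁ := hZ hD₁ χ hχ1 hA' U Φ (beta6 D - w) (betaJ c' D (j + 1)) (betaJ c' D (j + 2))
    (n := d * r) (Y := Y₁) (mul_ne_zero hd0 hr0) hlogn hUd hUb' hβa_re (hβ_norm _) hβb_re (hβ_norm _)
    hs₀norm hs₀im hΦ hTY₁ hY₁P
  -- (3) the small circle (pair form, with `ω₁`)
  have hΩ' := hΩ D χ hD₂ hq hp hA j d r hd0 hr0 U hUd hU3' w hw Y₁ Y₂ h1Y₁ hY₁P h1Y₂ hY₂P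
    (ell D ^ 30) hΛ1
  -- (4) the residue identity
  have h025' := h025 D χ hD₃ hq hp j hj d r hd hr w hw
  -- unfold `Φ` in (1), (2) so that the circle terms are those of (3)
  simp only [hΦdef] at hglue hZ₂ hZ₁
  -- abbreviations
  set V₂ : ℂ := (1 / (2 * π) : ℂ) * (∫ t : ℝ,
      U (1 - beta6 D + w + (((1 : ℝ) : ℂ) + t * I)) *
          χ.LFunction (1 - beta6 D + w + (((1 : ℝ) : ℂ) + t * I) + betaJ c' D (j + 1)) *
          χ.LFunction (1 - beta6 D + w + (((1 : ℝ) : ℂ) + t * I) + betaJ c' D (j + 2)) /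
          χ.LFunction (1 - beta6 D + w + (((1 : ℝ) : ℂ) + t * I)) *
        (((Y₂ : ℝ) : ℂ) ^ (((1 : ℝ) : ℂ) + t * I + 0) * omega1 (ell D ^ 30) (((1 : ℝ) : ℂ) + t * I + 0) /
          (((1 : ℝ) : ℂ) + t * I + 0))) with hV₂
  set V₁ : ℂ := (1 / (2 * π) : ℂ) * (∫ t : ℝ,
      U (1 - beta6 D + w + (((1 : ℝ) : ℂ) + t * I)) *
          χ.LFunction (1 - beta6 D + w + (((1 : ℝ) : ℂ) + t * I) + betaJ c' D (j + 1)) *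
          χ.LFunction (1 - beta6 D + w + (((1 : ℝ) : ℂ) + t * I) + betaJ c' D (j + 2)) /
          χ.LFunction (1 - beta6 D + w + (((1 : ℝ) : ℂ) + t * I)) *
        (((Y₁ : ℝ) : ℂ) ^ (((1 : ℝ) : ℂ) + t * I + 0) * omega1 (ell D ^ 30) (((1 : ℝ) : ℂ) + t * I + 0) /
          (((1 : ℝ) : ℂ) + t * I + 0))) with hV₁
  set A₂ : ℂ := (2 * π * I)⁻¹ * (∮ z in C(beta6 D - w, 3 * alpha D),
      U (1 - beta6 D + w + z) * χ.LFunction (1 - beta6 D + w + z + betaJ c' D (j + 1)) *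
          χ.LFunction (1 - beta6 D + w + z + betaJ c' D (j + 2)) /
          χ.LFunction (1 - beta6 D + w + z) *
        (((Y₂ : ℝ) : ℂ) ^ (z + 0) * omega1 (ell D ^ 30) (z + 0) / (z + 0))) with hA₂
  set A₁ : ℂ := (2 * π * I)⁻¹ * (∮ z in C(beta6 D - w, 3 * alpha D),
      U (1 - beta6 D + w + z) * χ.LFunction (1 - beta6 D + w + z + betaJ c' D (j + 1)) *
          χ.LFunction (1 - beta6 D + w + z + betaJ c' D (j + 2)) /
          χ.LFunction (1 - beta6 D + w + z) *
        (((Y₁ : ℝ) : ℂ) ^ (z + 0) * omega1 (ell D ^ 30) (z + 0) / (z + 0))) with hA₁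
  set M : ℂ := PiW χ d r * deriv χ.LFunction 1 *
      (betaJ c' D (j + 1) * betaJ c' D (j + 2) *
        ((((Y₂ : ℝ) : ℂ) ^ (beta6 D - w) - ((Y₁ : ℝ) : ℂ) ^ (beta6 D - w)) / (beta6 D - w))) with hM
  set hatPi : ℝ := ∏ q ∈ (d * r).primeFactors, (1 - (q : ℝ)⁻¹)⁻¹ with hhatPi
  -- the algebra
  have e : lineInt024 c' χ j d r w - deriv χ.LFunction 1 * PiW χ d r * circ025 c' D j d r w =
      (V₂ - A₂) - (V₁ - A₁) + ((A₂ - A₁) - M) := by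
    rw [hglue, h025', hM]
    ring
  rw [e]
  have hPi1 : 1 ≤ hatPi :=
    Literature.NumberTheory.Sieve.GreenTao2008.GYCorr.one_le_prod_one_sub_inv_inv (d * r)
  have hℓ15 : 0 ≤ (ell D ^ 15)⁻¹ := by positivity
  calc ‖(V₂ - A₂) - (V₁ - A₁) + ((A₂ - A₁) - M)‖
      ≤ ‖(V₂ - A₂) - (V₁ - A₁)‖ + ‖(A₂ - A₁) - M‖ := norm_add_le _ _
    _ ≤ (‖V₂ - A₂‖ + ‖V₁ - A₁‖) + ‖(A₂ - A₁) - M‖ := by gcongr; exact norm_sub_le _ _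
    _ ≤ (C₀ * (ell D ^ 15)⁻¹ + C₀ * (ell D ^ 15)⁻¹) + C₂ * (ell D ^ 15)⁻¹ * hatPi ^ 2 := by
        gcongr
    _ ≤ (2 * C₀ + C₂) * (ell D ^ 15)⁻¹ * hatPi ^ 2 := by
        have h1 : (1 : ℝ) ≤ hatPi ^ 2 := one_le_pow₀ hPi1
        have h2 : 0 ≤ C₀ * (ell D ^ 15)⁻¹ := by positivity
        nlinarith

/-- **`U025Rel` holds** (every `c′`): `u025Rel_of_lemma83Rel` applied to the tree's
`Skeleton.lemma83Rel_holds`. Plug for h1212 (kernel-probed shape of zl-w12-p4 g2):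
`Typed.Sec12C.eq1212_of_eq1210L15Rel′ hc′ (eq1210L15Rel_of_u024Rel_u025Rel c′ (u024Rel_holds c′) (u025Rel_holds c′))`.
[cite: Zhang2022LandauSiegel, §12 proof of Lemma 12.2, p. 69] -/
theorem u025Rel_holds : U025Rel c' :=
  u025Rel_of_lemma83Rel c' (lemma83Rel_holds c')

/-- `U025Rel` — `_holds` alias of `u025Rel_holds` above under the fact's exact name (appended
2026-08-28, D-0026 bookkeeping: the proof term is the existing theorem of this file; no statement,
definition or attribute is edited; no new named fact; the ledger's debt table listed the fact
unproved). [cite: Zhang2022LandauSiegel, §12 proof of Lemma 12.2, p. 69] -/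
theorem _root_.Literature.NumberTheory.LFunctions.Zhang2022.Typed.Sec12B.U025Rel_holds :
    U025Rel c' :=
  _root_.Literature.NumberTheory.LFunctions.Zhang2022.Typed.Sec12B.u025Rel_holds (c' := c')

/-- **(12.10) in the relative reading holds**: `Typed.Sec12B.Eq1210L15Rel c′` (the closed low range
`dr ≤ P″₁/T`, error `C𝓛⁻¹⁵Π̂(dr)²`) from `u024Rel_holds` (Section12U024RelHolds) and `u025Rel_holds`
by the tree's edge `eq1210L15Rel_of_u024Rel_u025Rel` (Section12RelEdges: u026 Cauchy step + (12.10)).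
[cite: Zhang2022LandauSiegel, §12 Lemma 12.2 (12.10), p. 69] -/
theorem eq1210L15Rel_holds : Eq1210L15Rel c' :=
  eq1210L15Rel_of_u024Rel_u025Rel c' (u024Rel_holds c') (u025Rel_holds c')

/-- `Eq1210L15Rel` — `_holds` alias of `eq1210L15Rel_holds` above under the fact's exact name (appended
2026-08-28, D-0026 bookkeeping: the proof term is the existing theorem of this file; no statement,
definition or attribute is edited; no new named fact; the ledger's debt table listed the fact
unproved). [cite: Zhang2022LandauSiegel, §12 Lemma 12.2 (12.10), p. 69] -/
theorem _root_.Literature.NumberTheory.LFunctions.Zhang2022.Typed.Sec12B.Eq1210L15Rel_holds :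
    Eq1210L15Rel c' :=
  _root_.Literature.NumberTheory.LFunctions.Zhang2022.Typed.Sec12B.eq1210L15Rel_holds (c' := c')

end Literature.NumberTheory.LFunctions.Zhang2022.Typed.Sec12B

namespace Literature.NumberTheory.LFunctions.Zhang2022.Typed.Sec12C

/-- **Leaf h1212 — `Typed.Sec12C.Eq1212 c′` ((12.12): the low range `dr ≤ P″₁/T` of `S_j(𝐚₁₂,𝐚₂₅)`)
HOLDS for every `c′ ≥ 0`**, BY NAME: the tree's relative edge `Typed.Sec12C.eq1212_of_eq1210L15Rel'`
(Section12Eq1212OfRel: Lemma 8.2 + (12.10)ᴿ + (8.10) + window bookkeeping, `K𝓛⁻¹²` vs `α = π𝓛⁻⁹`)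
applied to `Typed.Sec12B.eq1210L15Rel_holds`. Skeleton plug: `h1212 := fun c' hc => eq1212_holds (hc₁.trans hc)`.
[cite: Zhang2022LandauSiegel, §12 (12.12), p. 71] -/
theorem eq1212_holds {c' : ℝ} (hc' : 0 ≤ c') : Eq1212 c' :=
  eq1212_of_eq1210L15Rel' hc' (Sec12B.eq1210L15Rel_holds c')

/-- The same for all `c′ ≥ 0` at once. [cite: Zhang2022LandauSiegel, §12 (12.12), p. 71] -/
theorem eq1212_holds_all : ∀ c' : ℝ, 0 ≤ c' → Eq1212 c' :=
  fun _ hc' => eq1212_holds hc'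

end Literature.NumberTheory.LFunctions.Zhang2022.Typed.Sec12C
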